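import Mathlib
import HarnessLib
import Summits.HubbardSuperconductivity.HubbardSuperconductivity.Theorems.WeakCouplingBCSKlCertDOSQuadrature

/-!
# Route `WeakCouplingBCS` — crux `WcbcsBcsConstruction` (stmt-HubbardSuperconductivity-2010), stub `stub_klPointEnclosure` (Penc):
# quarter-turn-REDUCED rational enclosures of `cos y`, `sin y` for LARGE arguments, and a fast interval evaluation of tabulated
# trigonometric polynomials

Support for the in-kernel discharge of the kernel-free rows E1 (`Nlo ≤ ∫ Φ² dσ_μ ≤ Nhi`) of the one-point record `klPtBox` / `klPtTab`
(`Theorems/ChiralWindowDefsPointRecord.lean`; stub (Penc) of `Cruxes/WcbcsBcsConstruction/Lines/ladder_scale_certified_chain.lean`, shared with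
stmt-1740).  The record's `B1g` trial has 21 cosine terms with frequencies up to `j = 102`, so the quadrature points `j·x` reach `≈ 80`; the
adaptive-order Taylor evaluation of `WeakCouplingBCSKlCertTrigQuadrature.lean` (`qEvalLo/qEvalHi`, order `8 + 2⌊jx⌋`, i.e. up to 170 terms of
thousands of bits each) is then far too expensive for a kernel decision over hundreds of cells.  This file replaces it by RANGE REDUCTION:

* `pi2Lo20 < π/2 < pi2Hi20` — Mathlib's 20-digit bounds (`Real.pi_gt_d20`, `Real.pi_lt_d20`);
* `redK y = ⌊y / pi2Hi20⌋₊` quarter turns, `redLo y ≤ y - redK y · π/2 ≤ redHi y` (a rational interval of width `≤ redK y · 10⁻²¹`, with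
  `0 ≤ redLo y` for `y ≥ 0`);
* `cosRedLo/Hi`, `sinRedLo/Hi` — order-11/12 Taylor enclosures at `redLo y` padded by the interval width (`|cos a - cos b| ≤ |a - b|`);
* **`cosRLo y ≤ cos y ≤ cosRHi y`** (all `y`) and **`sinRLo y ≤ sin y ≤ sinRHi y`** (`y ≥ 0`) by the quarter-turn case `redK y % 4`
  (`cos (r + π/2) = -sin r`, …, `cos (x + n·2π) = cos x`);
* `rEvalLo t x ≤ t.eval x ≤ rEvalHi t x` for a tabulated trigonometric polynomial `t : KLTrig` at a rational point `x ≥ 0` — same interface as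
  `qEvalLo/qEvalHi`, so the cell checkers of the `KlCertQuad` chain files can switch evaluator without touching their soundness proofs' shape.

Everything is proved; the definitions are finite rational expressions (kernel-evaluable: `Rat` arithmetic, `Nat.floor`).  Honest framing: an
evaluator, no enclosure of the record is claimed here; nothing about a channel order, `U₀` or superconductivity. [folklore]
-/

noncomputable section

-- the tree's namespace `Summit.<Summit>.<Problem>.Theorems` repeats the summit name by design (D-0017)
set_option linter.dupNamespace false

namespace Summit.HubbardSuperconductivity.HubbardSuperconductivity.Theorems.KlCertQuad

open Real Set MeasureTheory CwKLChiralWindow Literature.MathematicalPhysics.QuantumLattice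

/-! ### Twenty-digit rational bounds of `π/2` -/

/-- A 20-digit rational lower bound of `π/2`. [folklore] -/
def pi2Lo20 : ℚ := 157079632679489661923 / 100000000000000000000
/-- A 20-digit rational upper bound of `π/2`. [folklore] -/
def pi2Hi20 : ℚ := 1570796326794896619235 / 1000000000000000000000

/-- `pi2Lo20 < π/2`. [folklore] -/
theorem pi2Lo20_lt : ((pi2Lo20 : ℚ) : ℝ) < π / 2 := by
  have := Real.pi_gt_d20; rw [pi2Lo20]; push_cast; linarith

/-- `π/2 < pi2Hi20`. [folklore] -/
theorem lt_pi2Hi20 : π / 2 < ((pi2Hi20 : ℚ) : ℝ) := by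
  have := Real.pi_lt_d20; rw [pi2Hi20]; push_cast; linarith

/-- `0 < pi2Hi20`. [folklore] -/
theorem pi2Hi20_pos : 0 < pi2Hi20 := by rw [pi2Hi20]; norm_num

/-! ### Quarter-turn reduction -/

/-- Number of quarter turns removed from `y`: `⌊y / pi2Hi20⌋₊`. [folklore] -/
def redK (y : ℚ) : ℕ := ⌊y / pi2Hi20⌋₊
/-- Rational lower end of the reduced argument `y - redK y · π/2`. [folklore] -/
def redLo (y : ℚ) : ℚ := y - (redK y : ℚ) * pi2Hi20
/-- Rational upper end of the reduced argument `y - redK y · π/2`. [folklore] -/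
def redHi (y : ℚ) : ℚ := y - (redK y : ℚ) * pi2Lo20

/-- The (real, irrational) reduced argument. [folklore] -/
def redArg (y : ℚ) : ℝ := (y : ℝ) - (redK y : ℝ) * (π / 2)

/-- `redLo y ≤ y - redK y · π/2`. [folklore] -/
theorem redLo_le_redArg (y : ℚ) : ((redLo y : ℚ) : ℝ) ≤ redArg y := by
  rw [redLo, redArg]; push_cast
  have hk : (0 : ℝ) ≤ (redK y : ℝ) := Nat.cast_nonneg _
  nlinarith [lt_pi2Hi20, mul_le_mul_of_nonneg_left lt_pi2Hi20.le hk]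

/-- `y - redK y · π/2 ≤ redHi y`. [folklore] -/
theorem redArg_le_redHi (y : ℚ) : redArg y ≤ ((redHi y : ℚ) : ℝ) := by
  rw [redHi, redArg]; push_cast
  have hk : (0 : ℝ) ≤ (redK y : ℝ) := Nat.cast_nonneg _
  nlinarith [pi2Lo20_lt, mul_le_mul_of_nonneg_left pi2Lo20_lt.le hk]

/-- For `y ≥ 0` the reduced interval starts at a non-negative rational. [folklore] -/
theorem redLo_nonneg {y : ℚ} (hy : 0 ≤ y) : 0 ≤ redLo y := by
  have h := Nat.floor_le (div_nonneg hy pi2Hi20_pos.le)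
  have h' : (⌊y / pi2Hi20⌋₊ : ℚ) * pi2Hi20 ≤ y := by
    rw [← le_div_iff₀ pi2Hi20_pos]; exact h
  rw [redLo, redK]; linarith

/-- For `y ≥ 0` the reduced argument is non-negative. [folklore] -/
theorem redArg_nonneg {y : ℚ} (hy : 0 ≤ y) : 0 ≤ redArg y :=
  le_trans (by exact_mod_cast redLo_nonneg hy) (redLo_le_redArg y)

/-- The quarter-turn decomposition of the argument: `y = (r + ρ·π/2) + q·2π` with `ρ = redK y % 4`, `q = redK y / 4`. [folklore] -/
theorem arg_eq_redArg_add (y : ℚ) :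
    (y : ℝ) = (redArg y + ((redK y % 4 : ℕ) : ℝ) * (π / 2)) + ((redK y / 4 : ℕ) : ℝ) * (2 * π) := by
  have hk : ((redK y : ℕ) : ℝ) = 4 * ((redK y / 4 : ℕ) : ℝ) + ((redK y % 4 : ℕ) : ℝ) := by
    have := Nat.div_add_mod (redK y) 4
    exact_mod_cast this.symm
  rw [redArg, hk]; ring

/-! ### Enclosures of `cos`, `sin` of the reduced argument -/

/-- Lower enclosure of `cos (redArg y)`: order-11 Taylor at `redLo y` minus the interval width. [folklore] -/
def cosRedLo (y : ℚ) : ℚ := qCosT 11 (redLo y) - (redHi y - redLo y)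
/-- Upper enclosure of `cos (redArg y)`. [folklore] -/
def cosRedHi (y : ℚ) : ℚ := qCosT 12 (redLo y) + (redHi y - redLo y)
/-- Lower enclosure of `sin (redArg y)` (valid for `y ≥ 0`). [folklore] -/
def sinRedLo (y : ℚ) : ℚ := qSinT 11 (redLo y) - (redHi y - redLo y)
/-- Upper enclosure of `sin (redArg y)` (valid for `y ≥ 0`). [folklore] -/
def sinRedHi (y : ℚ) : ℚ := qSinT 12 (redLo y) + (redHi y - redLo y)

/-- `cosRedLo y ≤ cos (redArg y) ≤ cosRedHi y`. [folklore] -/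
theorem cosRed_mem (y : ℚ) :
    ((cosRedLo y : ℚ) : ℝ) ≤ Real.cos (redArg y) ∧ Real.cos (redArg y) ≤ ((cosRedHi y : ℚ) : ℝ) := by
  have h₁ := Literature.Computability.MetaComplexity.cosTaylorSum_le_cos (M := 11) (by decide) ((redLo y : ℚ) : ℝ)
  have h₂ := Literature.Computability.MetaComplexity.cos_le_cosTaylorSum (M := 12) (by decide) ((redLo y : ℚ) : ℝ)
  rw [← cast_qCosT] at h₁ h₂
  have hlip := Real.abs_cos_sub_cos_le (redArg y) ((redLo y : ℚ) : ℝ)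
  have hw₁ := redLo_le_redArg y
  have hw₂ := redArg_le_redHi y
  rw [abs_le] at hlip
  have habs : |redArg y - ((redLo y : ℚ) : ℝ)| = redArg y - redLo y := abs_of_nonneg (by linarith)
  rw [habs] at hlip
  rw [cosRedLo, cosRedHi]; push_cast
  constructor <;> linarith [hlip.1, hlip.2]

/-- `sinRedLo y ≤ sin (redArg y) ≤ sinRedHi y` for `y ≥ 0`. [folklore] -/
theorem sinRed_mem {y : ℚ} (hy : 0 ≤ y) :
    ((sinRedLo y : ℚ) : ℝ) ≤ Real.sin (redArg y) ∧ Real.sin (redArg y) ≤ ((sinRedHi y : ℚ) : ℝ) := by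
  have h0 : (0 : ℝ) ≤ ((redLo y : ℚ) : ℝ) := by exact_mod_cast redLo_nonneg hy
  have h₁ := Literature.Computability.MetaComplexity.sinTaylorSum_le_sin (M := 11) (by decide) h0
  have h₂ := Literature.Computability.MetaComplexity.sin_le_sinTaylorSum (M := 12) (by decide) h0
  rw [← cast_qSinT] at h₁ h₂
  have hlip := Real.abs_sin_sub_sin_le (redArg y) ((redLo y : ℚ) : ℝ)
  have hw₁ := redLo_le_redArg y
  have hw₂ := redArg_le_redHi y
  rw [abs_le] at hlip
  have habs : |redArg y - ((redLo y : ℚ) : ℝ)| = redArg y - redLo y := abs_of_nonneg (by linarith)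
  rw [habs] at hlip
  rw [sinRedLo, sinRedHi]; push_cast
  constructor <;> linarith [hlip.1, hlip.2]

/-! ### Enclosures of `cos y`, `sin y` by the quarter-turn case -/

/-- Lower enclosure of `cos y` (case `redK y % 4`). [folklore] -/
def cosRLo (y : ℚ) : ℚ :=
  if redK y % 4 = 0 then cosRedLo y else if redK y % 4 = 1 then -sinRedHi y
  else if redK y % 4 = 2 then -cosRedHi y else sinRedLo y
/-- Upper enclosure of `cos y`. [folklore] -/
def cosRHi (y : ℚ) : ℚ :=
  if redK y % 4 = 0 then cosRedHi y else if redK y % 4 = 1 then -sinRedLo y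
  else if redK y % 4 = 2 then -cosRedLo y else sinRedHi y
/-- Lower enclosure of `sin y` (`y ≥ 0`). [folklore] -/
def sinRLo (y : ℚ) : ℚ :=
  if redK y % 4 = 0 then sinRedLo y else if redK y % 4 = 1 then cosRedLo y
  else if redK y % 4 = 2 then -sinRedHi y else -cosRedHi y
/-- Upper enclosure of `sin y` (`y ≥ 0`). [folklore] -/
def sinRHi (y : ℚ) : ℚ :=
  if redK y % 4 = 0 then sinRedHi y else if redK y % 4 = 1 then cosRedHi y
  else if redK y % 4 = 2 then -sinRedLo y else -cosRedLo y

/-- `cos y` and `sin y` through the reduced argument, by the case `ρ = redK y % 4`. [folklore] -/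
theorem cos_sin_eq_red (y : ℚ) :
    (redK y % 4 = 0 → Real.cos y = Real.cos (redArg y) ∧ Real.sin y = Real.sin (redArg y)) ∧
    (redK y % 4 = 1 → Real.cos y = -Real.sin (redArg y) ∧ Real.sin y = Real.cos (redArg y)) ∧
    (redK y % 4 = 2 → Real.cos y = -Real.cos (redArg y) ∧ Real.sin y = -Real.sin (redArg y)) ∧
    (redK y % 4 = 3 → Real.cos y = Real.sin (redArg y) ∧ Real.sin y = -Real.cos (redArg y)) := by
  have key := arg_eq_redArg_add y
  set r := redArg y
  set q : ℕ := redK y / 4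
  have hc : Real.cos y = Real.cos (r + ((redK y % 4 : ℕ) : ℝ) * (π / 2)) := by
    rw [key, Real.cos_add_nat_mul_two_pi]
  have hs : Real.sin y = Real.sin (r + ((redK y % 4 : ℕ) : ℝ) * (π / 2)) := by
    rw [key, Real.sin_add_nat_mul_two_pi]
  refine ⟨fun h => ?_, fun h => ?_, fun h => ?_, fun h => ?_⟩ <;> rw [hc, hs, h] <;> push_cast
  · simp
  · rw [one_mul, Real.cos_add_pi_div_two, Real.sin_add_pi_div_two]; simp
  · rw [show r + 2 * (π / 2) = r + π by ring, Real.cos_add_pi, Real.sin_add_pi]; simp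
  · rw [show r + 3 * (π / 2) = (r + π) + π / 2 by ring, Real.cos_add_pi_div_two, Real.sin_add_pi_div_two,
      Real.sin_add_pi, Real.cos_add_pi]; simp

/-- **`cosRLo y ≤ cos y ≤ cosRHi y`** for every rational `y ≥ 0`. [folklore] -/
theorem cosR_mem {y : ℚ} (hy : 0 ≤ y) : ((cosRLo y : ℚ) : ℝ) ≤ Real.cos y ∧ Real.cos y ≤ ((cosRHi y : ℚ) : ℝ) := by
  obtain ⟨hc₁, hc₂⟩ := cosRed_mem y
  obtain ⟨hs₁, hs₂⟩ := sinRed_mem hy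
  obtain ⟨k0, k1, k2, k3⟩ := cos_sin_eq_red y
  unfold cosRLo cosRHi
  by_cases h0 : redK y % 4 = 0
  · simp only [h0, if_true]; rw [(k0 h0).1]; exact ⟨hc₁, hc₂⟩
  by_cases h1 : redK y % 4 = 1
  · simp only [h1, if_true]; push_cast; rw [(k1 h1).1]; constructor <;> linarith
  by_cases h2 : redK y % 4 = 2
  · simp only [h2, if_true]; push_cast; rw [(k2 h2).1]; constructor <;> linarith
  have h3 : redK y % 4 = 3 := by omega
  simp only [h3]; push_cast; rw [(k3 h3).1]; exact ⟨hs₁, hs₂⟩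

/-- **`sinRLo y ≤ sin y ≤ sinRHi y`** for every rational `y ≥ 0`. [folklore] -/
theorem sinR_mem {y : ℚ} (hy : 0 ≤ y) : ((sinRLo y : ℚ) : ℝ) ≤ Real.sin y ∧ Real.sin y ≤ ((sinRHi y : ℚ) : ℝ) := by
  obtain ⟨hc₁, hc₂⟩ := cosRed_mem y
  obtain ⟨hs₁, hs₂⟩ := sinRed_mem hy
  obtain ⟨k0, k1, k2, k3⟩ := cos_sin_eq_red y
  unfold sinRLo sinRHi
  by_cases h0 : redK y % 4 = 0
  · simp only [h0, if_true]; rw [(k0 h0).2]; exact ⟨hs₁, hs₂⟩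
  by_cases h1 : redK y % 4 = 1
  · simp only [h1, if_true]; push_cast; rw [(k1 h1).2]; exact ⟨hc₁, hc₂⟩
  by_cases h2 : redK y % 4 = 2
  · simp only [h2, if_true]; push_cast; rw [(k2 h2).2]; constructor <;> linarith
  have h3 : redK y % 4 = 3 := by omega
  simp only [h3]; push_cast; rw [(k3 h3).2]; constructor <;> linarith

/-! ### Signed multiples and lists (mirror of `mulCosLo` … `qEvalHi` with the reduced enclosures) -/

/-- Lower enclosure of `c · cos y` (`y ≥ 0`), by the sign of `c`. [folklore] -/
def mulCosRLo (c y : ℚ) : ℚ := if 0 ≤ c then c * cosRLo y else c * cosRHi y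
/-- Upper enclosure of `c · cos y` (`y ≥ 0`). [folklore] -/
def mulCosRHi (c y : ℚ) : ℚ := if 0 ≤ c then c * cosRHi y else c * cosRLo y
/-- Lower enclosure of `c · sin y` (`y ≥ 0`). [folklore] -/
def mulSinRLo (c y : ℚ) : ℚ := if 0 ≤ c then c * sinRLo y else c * sinRHi y
/-- Upper enclosure of `c · sin y` (`y ≥ 0`). [folklore] -/
def mulSinRHi (c y : ℚ) : ℚ := if 0 ≤ c then c * sinRHi y else c * sinRLo y

/-- Soundness of `mulCosRLo` / `mulCosRHi`. [folklore] -/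
theorem mulCosR_mem (c : ℚ) {y : ℚ} (hy : 0 ≤ y) :
    ((mulCosRLo c y : ℚ) : ℝ) ≤ (c : ℝ) * Real.cos y ∧ (c : ℝ) * Real.cos y ≤ ((mulCosRHi c y : ℚ) : ℝ) := by
  obtain ⟨h₁, h₂⟩ := cosR_mem hy
  unfold mulCosRLo mulCosRHi
  split_ifs with hc
  · have hc' : (0 : ℝ) ≤ c := by exact_mod_cast hc
    push_cast; exact ⟨mul_le_mul_of_nonneg_left h₁ hc', mul_le_mul_of_nonneg_left h₂ hc'⟩
  · have hc' : (c : ℝ) ≤ 0 := by push_cast [not_le] at hc; exact_mod_cast hc.le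
    push_cast; exact ⟨mul_le_mul_of_nonpos_left h₂ hc', mul_le_mul_of_nonpos_left h₁ hc'⟩

/-- Soundness of `mulSinRLo` / `mulSinRHi`. [folklore] -/
theorem mulSinR_mem (c : ℚ) {y : ℚ} (hy : 0 ≤ y) :
    ((mulSinRLo c y : ℚ) : ℝ) ≤ (c : ℝ) * Real.sin y ∧ (c : ℝ) * Real.sin y ≤ ((mulSinRHi c y : ℚ) : ℝ) := by
  obtain ⟨h₁, h₂⟩ := sinR_mem hy
  unfold mulSinRLo mulSinRHi
  split_ifs with hc
  · have hc' : (0 : ℝ) ≤ c := by exact_mod_cast hc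
    push_cast; exact ⟨mul_le_mul_of_nonneg_left h₁ hc', mul_le_mul_of_nonneg_left h₂ hc'⟩
  · have hc' : (c : ℝ) ≤ 0 := by push_cast [not_le] at hc; exact_mod_cast hc.le
    push_cast; exact ⟨mul_le_mul_of_nonpos_left h₂ hc', mul_le_mul_of_nonpos_left h₁ hc'⟩

/-- Lower interval evaluation of a cosine coefficient list at `x ≥ 0` (reduced enclosures). [folklore] -/
def cosListRLo (L : List (ℕ × ℚ)) (x : ℚ) : ℚ := (L.map fun p => mulCosRLo p.2 (p.1 * x)).sum
/-- Upper interval evaluation of a cosine coefficient list at `x ≥ 0`. [folklore] -/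
def cosListRHi (L : List (ℕ × ℚ)) (x : ℚ) : ℚ := (L.map fun p => mulCosRHi p.2 (p.1 * x)).sum
/-- Lower interval evaluation of a sine coefficient list at `x ≥ 0`. [folklore] -/
def sinListRLo (L : List (ℕ × ℚ)) (x : ℚ) : ℚ := (L.map fun p => mulSinRLo p.2 (p.1 * x)).sum
/-- Upper interval evaluation of a sine coefficient list at `x ≥ 0`. [folklore] -/
def sinListRHi (L : List (ℕ × ℚ)) (x : ℚ) : ℚ := (L.map fun p => mulSinRHi p.2 (p.1 * x)).sum

/-- Soundness of `cosListRLo` / `cosListRHi`. [folklore] -/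
theorem cosListR_mem (L : List (ℕ × ℚ)) {x : ℚ} (hx : 0 ≤ x) :
    ((cosListRLo L x : ℚ) : ℝ) ≤ (L.map fun p : ℕ × ℚ => (p.2 : ℝ) * Real.cos ((p.1 : ℝ) * x)).sum ∧
      (L.map fun p : ℕ × ℚ => (p.2 : ℝ) * Real.cos ((p.1 : ℝ) * x)).sum ≤ ((cosListRHi L x : ℚ) : ℝ) := by
  induction L with
  | nil => simp [cosListRLo, cosListRHi]
  | cons p L ih =>
    simp only [cosListRLo, cosListRHi, List.map_cons, List.sum_cons, Rat.cast_add] at ih ⊢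
    have h := mulCosR_mem p.2 (y := p.1 * x) (by positivity)
    push_cast at h
    exact ⟨add_le_add h.1 ih.1, add_le_add h.2 ih.2⟩

/-- Soundness of `sinListRLo` / `sinListRHi`. [folklore] -/
theorem sinListR_mem (L : List (ℕ × ℚ)) {x : ℚ} (hx : 0 ≤ x) :
    ((sinListRLo L x : ℚ) : ℝ) ≤ (L.map fun p : ℕ × ℚ => (p.2 : ℝ) * Real.sin ((p.1 : ℝ) * x)).sum ∧
      (L.map fun p : ℕ × ℚ => (p.2 : ℝ) * Real.sin ((p.1 : ℝ) * x)).sum ≤ ((sinListRHi L x : ℚ) : ℝ) := by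
  induction L with
  | nil => simp [sinListRLo, sinListRHi]
  | cons p L ih =>
    simp only [sinListRLo, sinListRHi, List.map_cons, List.sum_cons, Rat.cast_add] at ih ⊢
    have h := mulSinR_mem p.2 (y := p.1 * x) (by positivity)
    push_cast at h
    exact ⟨add_le_add h.1 ih.1, add_le_add h.2 ih.2⟩

/-- **Lower interval evaluation of `t.eval` at a rational point `x ≥ 0`** (reduced enclosures, any frequency). [folklore] -/
def rEvalLo (t : KLTrig) (x : ℚ) : ℚ := cosListRLo t.cosC x + sinListRLo t.sinC x
/-- **Upper interval evaluation of `t.eval` at a rational point `x ≥ 0`.** [folklore] -/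
def rEvalHi (t : KLTrig) (x : ℚ) : ℚ := cosListRHi t.cosC x + sinListRHi t.sinC x

/-- Soundness of `rEvalLo`. [folklore] -/
theorem rEvalLo_le (t : KLTrig) {x : ℚ} (hx : 0 ≤ x) : ((rEvalLo t x : ℚ) : ℝ) ≤ t.eval x := by
  rw [rEvalLo, KLTrig.eval]; push_cast
  exact add_le_add (cosListR_mem _ hx).1 (sinListR_mem _ hx).1

/-- Soundness of `rEvalHi`. [folklore] -/
theorem le_rEvalHi (t : KLTrig) {x : ℚ} (hx : 0 ≤ x) : t.eval x ≤ ((rEvalHi t x : ℚ) : ℝ) := by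
  rw [rEvalHi, KLTrig.eval]; push_cast
  exact add_le_add (cosListR_mem _ hx).2 (sinListR_mem _ hx).2

/-- A two-term sample with a high frequency (`cos 2x + 10⁻³ cos 102x`), for the kernel smoke test. [folklore] -/
def smokeTrig : KLTrig := ⟨[(2, (1 : ℚ)), (102, (1 : ℚ) / 1000)], [(101, (1 : ℚ) / 1000)]⟩

/-- Kernel smoke test: at `x = 201/256` (`102·x ≈ 80`, i.e. 50 quarter turns) the reduced evaluation brackets `smokeTrig.eval x` inside an
interval of width `< 10⁻¹⁷` (exact rational arithmetic, Taylor orders 11/12 on the reduced arguments). [folklore] -/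
theorem rEval_smoke :
    rEvalHi smokeTrig ((201 : ℚ) / 256) - rEvalLo smokeTrig ((201 : ℚ) / 256) < 1 / 100000000000000000 := by
  decide +kernel

end Summit.HubbardSuperconductivity.HubbardSuperconductivity.Theorems.KlCertQuad

end
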